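import Mathlib.Combinatorics.SimpleGraph.Girth
import Mathlib.Data.Set.Card
import Mathlib.Data.Real.Basic
import Mathlib.Algebra.BigOperators.Group.Finset.Basic
import HarnessLib

/-!
# The Moore bound for irregular graphs (Alon–Hoory–Linial 2002)

Named fact (D-0014, nothing is asserted) from extremal graph theory, topic
`Literature/Combinatorics/SimpleGraph`.

**The Moore bound.** For `d ≥ 2` and `g ≥ 3` put (Alon–Hoory–Linial, p. 53; Biggs,
*Algebraic Graph Theory*, p. 180)

* `n₀(d, 2r+1) = 1 + d · Σ_{i<r} (d−1)^i`,
* `n₀(d, 2r)   = 2 · Σ_{i<r} (d−1)^i`.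

For a `d`-regular graph of girth `g` the ball of radius `⌊(g−1)/2⌋` around a vertex (odd `g`)
or an edge (even `g`) is a tree, whence `n ≥ n₀(d, g)`.

**Theorem 1 of [AlonHooryLinial2002]** (verbatim, p. 54): *The number of vertices `n` in a graph
of girth `g` and average degree at least `d ≥ 2`, satisfies `n(d, g) ≥ n₀(d, g)`.* Here the
average degree is `2|E|/n`, and "girth `g`" means the shortest cycle has length exactly `g`
(so the graph has a cycle; since `n₀(d, ·)` is monotone for `d ≥ 2`, the same bound follows for
graphs all of whose cycles have length `≥ g`). This answered Bollobás, *Extremal Graph Theory*,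
p. 163, Problem 10.

We vend the theorem on vertex sets `Fin n` with Mathlib's `SimpleGraph.egirth : ℕ∞` and the edge
count `G.edgeSet.ncard` (the binders used by the consumer below), as the `Prop`-valued
definition `alonHooryLinial_mooreBound`; users take `(h : alonHooryLinial_mooreBound)`.

**Consumer.** Grounds `Summit.ValiantsHypothesis.ValiantsHypothesis.Theses.GirthSidon.ShortEvenCycle`
(route GirthSidon of `ValiantsHypothesis`, the "weak Bondy–Simonovits" support item: a simple
graph on `N ≥ 1` vertices with `e` edges and `4^k N^{k+1} ≤ e^k` has an even cycle of length
`≤ 2k`). Derivation on paper: pass to a bipartite subgraph `H` with `≥ e/2` edges (Erdős; every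
graph has a bipartite subgraph with at least half the edges), whose average degree on the same
`N` vertices is `≥ e/N ≥ 4N^{1/k} ≥ 2`; if `H` had no cycle of length `≤ 2k` then, being
bipartite, its girth would be some `g ≥ 2k+2` (or `H` acyclic, impossible at average degree
`≥ 2`), and Theorem 1 gives `N ≥ n₀(d, g) ≥ n₀(d, 2k+2) = 2Σ_{i≤k}(d−1)^i > (d−1)^k ≥
(4N^{1/k} − 1)^k > N`, a contradiction. (The item is also provable directly by the minimum-degree
Moore argument — delete vertices of degree `< e/(2N)` — without this fact; Mathlib has
`SimpleGraph.egirth`/`girth` and `SimpleGraph.extremalNumber` but no Moore-type bound and no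
even-cycle (Bondy–Simonovits) theorem as of this file.) The stronger printed even-cycle theorem,
Bondy–Simonovits 1974 Thm 1 (`e > 100k·n^{1+1/k}` ⇒ `C_{2l} ⊆ G` for all `l ∈ [k, k n^{1/k}]`),
has constant `100k > 4` and so does NOT imply the item as typed.

## References

* N. Alon, S. Hoory, N. Linial, The Moore bound for irregular graphs, *Graphs Combin.* 18
  (2002) 53–57, Theorem 1 [AlonHooryLinial2002].
* J. A. Bondy, M. Simonovits, Cycles of even length in graphs, *J. Combin. Theory Ser. B* 16
  (1974) 97–105, Theorem 1 [BondySimonovits1974].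
-/

namespace Literature.Combinatorics.SimpleGraph

open _root_.SimpleGraph

/-- **The Moore bound** `n₀(d, g)` as a real number, for real "degree" `d` and girth `g`:
`n₀(d, 2r+1) = 1 + d Σ_{i<r} (d−1)^i` and `n₀(d, 2r) = 2 Σ_{i<r} (d−1)^i`
(so `n₀(d,0) = 0`, `n₀(d,1) = 1`, `n₀(d,2) = 2`, `n₀(d,3) = 1 + d`, `n₀(d,4) = 2d`, …).
[cite: AlonHooryLinial2002, p. 53] -/
noncomputable def mooreBound (d : ℝ) (g : ℕ) : ℝ :=
  if Even g then 2 * ∑ i ∈ Finset.range (g / 2), (d - 1) ^ i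
  else 1 + d * ∑ i ∈ Finset.range (g / 2), (d - 1) ^ i

/-- **Alon–Hoory–Linial, the Moore bound for irregular graphs** (Theorem 1, verbatim: "The
number of vertices `n` in a graph of girth `g` and average degree at least `d ≥ 2`, satisfies
`n(d, g) ≥ n₀(d, g)`"). Binders: a simple graph `G` on `Fin n` whose shortest cycle has length
exactly `g` (`G.egirth = g`, in particular `G` has a cycle), a real `d ≥ 2` with
`d ≤ 2|E(G)|/n` written multiplicatively as `d · n ≤ 2 · |E(G)|`; conclusion `n₀(d, g) ≤ n`.
Grounds `Summit.ValiantsHypothesis.ValiantsHypothesis.Theses.GirthSidon.ShortEvenCycle` (see the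
module docstring for the derivation). Named fact, not proved here.
[cite: AlonHooryLinial2002, Thm 1] -/
def alonHooryLinial_mooreBound : Prop :=
  ∀ (n g : ℕ) (d : ℝ) (G : _root_.SimpleGraph (Fin n)), G.egirth = (g : ℕ∞) → 2 ≤ d →
    d * (n : ℝ) ≤ 2 * (G.edgeSet.ncard : ℝ) → mooreBound d g ≤ (n : ℝ)

end Literature.Combinatorics.SimpleGraph
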